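import Literature.NumberTheory.ModularForms.PoincareSeriesWeightTwoHeckeConvergence
import HarnessLib

/-!
# Unfolding the Hecke-regularised weight-2 Poincaré series against a cusp form, I:
# the pointwise identities (proofs only)

Topic `Literature/NumberTheory/ModularForms` (namespace `Literature.NumberTheory.ModularForms.PoincareWeightTwo`,
continuing `PoincareSeriesWeightTwoHecke.lean` / `…Convergence.lean`). THEOREMS ONLY: the algebraic
half of stub U (`stub_heckeUnfolding`, Prop `HeckeUnfolding`) of the fact skeleton I1 `poincare-hecke`
for `kowalskiMichel2000_peterssonFormula` (crux item stmt-Parity-20404) — Iwaniec–Kowalski, Lemma 14.3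
(the unfolding `∫_{Γ₀(N)\ℍ} conj(P_m) f y^k dμ = ∫₀^∞∫₀¹ …`), at `k = 2` with Hecke's factor.

With the **seed** `h_{m,s,f}(w) = conj(e(mw)) · (Im w)^{s+2} · f(w)` (`poincareSeed`, written out inline):

* `conj_poincareTerm_mul_eq_seed_smul` — for a row `v` and `w ∈ ℍ`,
  `conj(poincareTerm_v(w)) · (Im w)^{s+2} f(w) = h(γ_v w)` (modularity `f(γ_v w) = j_v(w)² f(w)`,
  `Im γ_v w = Im w/|j_v(w)|²`, and `j conj(j) = |j|²`);
* `petersson_rpow_mul_poincareHecke_eq_tsum` — the Petersson integrand of `yˢ P_m(·,s)` against `f` is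
  `½ Σ'_v h(γ_v w)`;
* `seed_T_zpow_smul` — `h(Tⁿ w) = h(w)`;
* `tsum_gamma0_indicator_seed_eq_tsum_rows` — the `Γ₀(N)`-periodisation of `1_{0 ≤ Re < 1} · h` is the
  row sum: `Σ'_{δ ∈ Γ₀(N)} (1_P h)(δ w) = Σ'_v h(γ_v w)` (`Γ₀(N) = ⨆_v Γ_∞⁺ γ_v`, tree
  `bijective_T_zpow_mul_rowSection`; exactly one `Tⁿ γ_v w` lies in the strip `P`).

The measure-theoretic half (integrability of the seed on `P`, the strip integral
`∫_P h dμ = Γ(s+1)(4πm)^{−s−1} a_f(m)`, and the assembly with the tree's unfolding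
`Unfolding.integral_fd_sum_tsum_smul_eq`) is the sequel `…HeckeUnfolding.lean`.

Cell `landau-siegel` / `ls-inputs` (D-0154 (2)), seat `ls-inputs-I1-w2`. «The programme SEARCHES and
TYPES; no claim about Landau–Siegel zeros, Theorems 1–2 of arXiv:2211.02515 or a repaired Margin232
until a kernel theorem says so.»

## References

* [IwaniecKowalski2004] H. Iwaniec, E. Kowalski, *Analytic Number Theory*, Lemma 14.3 and its proof
  (unfolding), §14.1 (14.4), §3.2 (Hecke's trick).
* [Iwaniec2002] H. Iwaniec, *Spectral Methods of Automorphic Forms*, §3.2 (3.13) (unfolding).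
-/

noncomputable section

open scoped MatrixGroups Real ModularForm ComplexConjugate
open CongruenceSubgroup Complex
open UpperHalfPlane hiding I
open Literature.NumberTheory.EllipticCurves.ModularForms

namespace Literature.NumberTheory.ModularForms.PoincareWeightTwo

variable {N : ℕ}

/-! ### The seed and one term -/

/-- `denom γ_v w = j_v(w) = cw + d` for the explicit matrix over the row `v = (c, d)`.
[cite: IwaniecKowalski2004, §14.1 (14.4)] -/
theorem denom_rowMatrix (v : Fin 2 → ℤ) (hv : IsCoprime (v 0) (v 1)) (w : ℍ) :
    denom (rowMatrix v hv) w = rowDenom v w := by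
  rw [ModularGroup.denom_apply]; rfl

/-- `Im (γ_v w) = Im w / |j_v(w)|²`. [cite: IwaniecKowalski2004, §14.1 (14.4)] -/
theorem im_rowMatrix_smul (v : Fin 2 → ℤ) (hv : IsCoprime (v 0) (v 1)) (w : ℍ) :
    (rowMatrix v hv • w).im = w.im / ‖rowDenom v w‖ ^ 2 := by
  rw [ModularGroup.im_smul_eq_div_normSq, denom_rowMatrix, Complex.normSq_eq_norm_sq]

/-- Weight-2 modularity along a row: `f(γ_v w) = j_v(w)² f(w)` for `f ∈ S_2(Γ₀(N))`, `v ∈ Row N`.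
[cite: IwaniecKowalski2004, §14.1 (14.1)] -/
theorem cuspForm_rowMatrix_smul [NeZero N] (f : CuspForm (Gamma0 N) 2) (v : Row N) (w : ℍ) :
    f (rowMatrix v.1 v.2.1 • w) = rowDenom v.1 w ^ 2 * f w := by
  rw [SlashInvariantForm.slash_action_eqn_SL'' f (rowMatrix_mem_Gamma0 v) w, denom_rowMatrix]
  norm_cast

/-- **One term, conjugated, against `y^{s+2} f`, is the seed at `γ_v w`:**
`conj((cw+d)⁻²|cw+d|^{−2s} e(mγ_v w)) · (Im w)^{s+2} f(w) = conj(e(m γ_v w)) (Im γ_v w)^{s+2} f(γ_v w)`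
(Iwaniec–Kowalski, proof of Lemma 14.3: `f(γw) = j² f(w)`, `Im γw = Im w/|j|²`, `j·conj j = |j|²`).
[cite: IwaniecKowalski2004, Lemma 14.3 (proof)] -/
theorem conj_poincareTerm_mul_eq_seed_smul [NeZero N] (m : ℕ) (s : ℝ) (f : CuspForm (Gamma0 N) 2)
    (v : Row N) (w : ℍ) :
    conj (poincareTerm N m s v w) * ((w.im ^ (s + 2) : ℝ) : ℂ) * f w =
      conj (cexp (2 * π * I * m * ((rowMatrix v.1 v.2.1 • w : ℍ) : ℂ))) *
        (((rowMatrix v.1 v.2.1 • w).im ^ (s + 2) : ℝ) : ℂ) * f (rowMatrix v.1 v.2.1 • w) := by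
  set j : ℂ := rowDenom v.1 w with hjdef
  have hj : j ≠ 0 := rowDenom_ne_zero v.1 v.2.1 w
  have hJ : 0 < ‖j‖ := norm_pos_iff.mpr hj
  have hy : 0 < w.im := w.im_pos
  rw [im_rowMatrix_smul, cuspForm_rowMatrix_smul, ← hjdef]
  unfold poincareTerm
  rw [← hjdef, map_mul, map_mul, map_inv₀, map_pow, Complex.conj_ofReal]
  -- real-power bookkeeping: `A = (‖j‖²)ˢ`
  have hJ2 : 0 < ‖j‖ ^ 2 := by positivity
  have hA : ‖j‖ ^ (-(2 * s)) = ((‖j‖ ^ 2) ^ s)⁻¹ := by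
    rw [Real.rpow_neg hJ.le, Real.rpow_mul hJ.le, Real.rpow_two]
  have hB : (w.im / ‖j‖ ^ 2) ^ (s + 2) = w.im ^ (s + 2) / ((‖j‖ ^ 2) ^ s * (‖j‖ ^ 2) ^ 2) := by
    rw [Real.div_rpow hy.le hJ2.le, Real.rpow_add hJ2, Real.rpow_two]
  rw [hA, hB]
  have hAS : ((‖j‖ ^ 2) ^ s : ℝ) ≠ 0 := (Real.rpow_pos_of_pos hJ2 s).ne'
  have hconj : conj j = ((‖j‖ ^ 2 : ℝ) : ℂ) / j := by
    rw [eq_div_iff hj, Complex.conj_mul']; push_cast; ring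
  have hcj : conj j ≠ 0 := by rw [hconj]; exact div_ne_zero (by exact_mod_cast hJ2.ne') hj
  rw [hconj]
  push_cast
  field_simp

/-- **The Petersson integrand of `yˢ P_m(·, s)` against `f` is half the row sum of the seed**:
`conj(yˢ P_m(w,s)) f(w) y² = ½ Σ'_v conj(e(mγ_v w)) (Im γ_v w)^{s+2} f(γ_v w)` (no convergence
needed: `conj` and scalars pass through `tsum`). [cite: IwaniecKowalski2004, Lemma 14.3 (proof)] -/
theorem petersson_rpow_mul_poincareHecke_eq_tsum [NeZero N] (m : ℕ) (s : ℝ)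
    (f : CuspForm (Gamma0 N) 2) (w : ℍ) :
    petersson 2 (fun z : ℍ ↦ ((z.im ^ s : ℝ) : ℂ) * poincareHecke N m s z) ⇑f w =
      (1 / 2 : ℂ) * ∑' v : Row N, conj (cexp (2 * π * I * m * ((rowMatrix v.1 v.2.1 • w : ℍ) : ℂ))) *
        (((rowMatrix v.1 v.2.1 • w).im ^ (s + 2) : ℝ) : ℂ) * f (rowMatrix v.1 v.2.1 • w) := by
  simp_rw [← conj_poincareTerm_mul_eq_seed_smul m s f]
  unfold petersson poincareHecke
  rw [map_mul, Complex.conj_ofReal, map_mul, Complex.conj_tsum, tsum_mul_right, tsum_mul_right]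
  have h12 : conj (1 / 2 : ℂ) = 1 / 2 := by rw [map_div₀, map_one, map_ofNat]
  rw [h12]
  have hy : 0 < w.im := w.im_pos
  have hpow : ((w.im ^ (s + 2) : ℝ) : ℂ) = ((w.im ^ s : ℝ) : ℂ) * (w.im : ℂ) ^ (2 : ℕ) := by
    rw [Real.rpow_add hy, Real.rpow_two]; push_cast; ring
  rw [hpow]
  simp only [zpow_ofNat]
  ring

/-! ### Periodicity of the seed and the `Γ₀(N)`-periodisation of its strip cut-off -/

/-- `Tⁿ ∈ Γ₀(N)` acts by `w ↦ w + n`, and the seed is `T`-periodic: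
`h(Tⁿ w) = h(w)` (`e(m(w+n)) = e(mw)`, `Im` unchanged, `f(w+n) = f(w)`). [cite: IwaniecKowalski2004, Lemma 14.3 (proof)] -/
theorem seed_T_zpow_smul [NeZero N] (m : ℕ) (s : ℝ) (f : CuspForm (Gamma0 N) 2) (n : ℤ) (w : ℍ) :
    conj (cexp (2 * π * I * m * ((ModularGroup.T ^ n • w : ℍ) : ℂ))) *
        (((ModularGroup.T ^ n • w).im ^ (s + 2) : ℝ) : ℂ) * f (ModularGroup.T ^ n • w) =
      conj (cexp (2 * π * I * m * (w : ℂ))) * ((w.im ^ (s + 2) : ℝ) : ℂ) * f w := by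
  have hf : f (ModularGroup.T ^ n • w) = f w := by
    rw [SlashInvariantForm.slash_action_eqn_SL'' f (T_zpow_mem_Gamma0 N n) w, ModularGroup.denom_apply,
      ModularGroup.coe_T_zpow]
    simp
  rw [hf, UpperHalfPlane.modular_T_zpow_smul, UpperHalfPlane.vadd_im, UpperHalfPlane.coe_vadd]
  congr 2
  rw [mul_add, Complex.exp_add]
  have hper : cexp (2 * π * I * m * ((n : ℝ) : ℂ)) = 1 := by
    rw [← Complex.exp_int_mul_two_pi_mul_I ((m : ℤ) * n)]
    congr 1; push_cast; ring
  rw [hper, one_mul]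

/-- The unique integer translate of a point of `ℍ` into the strip `0 ≤ Re < 1` is by `n = −⌊Re⌋`.
[folklore] -/
private theorem T_zpow_smul_mem_strip_iff (w : ℍ) (n : ℤ) :
    (0 ≤ (ModularGroup.T ^ n • w).re ∧ (ModularGroup.T ^ n • w).re < 1) ↔ n = -⌊w.re⌋ := by
  rw [UpperHalfPlane.modular_T_zpow_smul, UpperHalfPlane.vadd_re]
  constructor
  · rintro ⟨h0, h1⟩
    have : ⌊w.re⌋ = -n := by
      rw [Int.floor_eq_iff]; push_cast; constructor <;> linarith
    omega
  · rintro rfl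
    push_cast
    constructor <;> linarith [Int.floor_le w.re, Int.lt_floor_add_one w.re]

/-- **The `Γ₀(N)`-periodisation of the strip cut-off of a `T`-periodic function is its row sum**:
for `H : ℍ → ℂ` with `H(Tⁿ w) = H(w)`,
`Σ'_{δ ∈ Γ₀(N)} 1_{0 ≤ Re < 1}(δ w) H(δ w) = Σ'_{v ∈ Row N} H(γ_v w)`
(`δ = Tⁿ γ_v` uniquely, tree `bijective_T_zpow_mul_rowSection`; for each row exactly one `n` puts
`Tⁿ γ_v w` in the strip; re-indexing by an injection whose range contains the support, no convergence
needed). [cite: Iwaniec2002, §3.2 (3.13)] -/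
theorem tsum_gamma0_indicator_eq_tsum_rows [NeZero N] (H : ℍ → ℂ)
    (hT : ∀ (n : ℤ) (w : ℍ), H (ModularGroup.T ^ n • w) = H w) (w : ℍ) :
    ∑' δ : Gamma0 N, {u : ℍ | 0 ≤ u.re ∧ u.re < 1}.indicator H ((δ : SL(2, ℤ)) • w) =
      ∑' v : Row N, H (rowMatrix v.1 v.2.1 • w) := by
  classical
  -- the section `v ↦ γ_v` and the bijection `(n, v) ↦ Tⁿ γ_v`
  have hγ : ∀ v : Row N, (rowMatrix v.1 v.2.1) 1 0 = v.1 0 ∧ (rowMatrix v.1 v.2.1) 1 1 = v.1 1 :=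
    fun v ↦ ⟨rowMatrix_apply_one_zero v.1 v.2.1, rowMatrix_apply_one_one v.1 v.2.1⟩
  have hbij := bijective_T_zpow_mul_rowSection (fun v : Row N ↦ rowMatrix v.1 v.2.1) hγ
  -- the injection `ι v = T^{n(v)} γ_v`, `n(v) = -⌊Re γ_v w⌋`
  set nv : Row N → ℤ := fun v ↦ -⌊(rowMatrix v.1 v.2.1 • w).re⌋ with hnv
  set ι : Row N → Gamma0 N := fun v ↦
    ⟨ModularGroup.T ^ (nv v) * rowMatrix v.1 v.2.1,
      mul_mem (T_zpow_mem_Gamma0 N (nv v)) (rowMatrix_mem_Gamma0 v)⟩ with hι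
  have hιinj : Function.Injective ι := by
    intro v₁ v₂ h
    have h' := hbij.1 (a₁ := (nv v₁, v₁)) (a₂ := (nv v₂, v₂)) (by simpa [hι] using h)
    exact (Prod.mk.inj h').2
  -- its range contains the support of the periodisation
  have hsupp : Function.support
      (fun δ : Gamma0 N ↦ {u : ℍ | 0 ≤ u.re ∧ u.re < 1}.indicator H ((δ : SL(2, ℤ)) • w)) ⊆
      Set.range ι := by
    intro δ hδ
    rw [Function.mem_support] at hδ
    have hmem : ((δ : SL(2, ℤ)) • w) ∈ {u : ℍ | 0 ≤ u.re ∧ u.re < 1} := by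
      by_contra hnot
      exact hδ (Set.indicator_of_notMem hnot _)
    obtain ⟨⟨n, v⟩, hnvδ⟩ := hbij.2 δ
    have hδeq : (δ : SL(2, ℤ)) = ModularGroup.T ^ n * rowMatrix v.1 v.2.1 := by
      rw [← hnvδ]
    rw [hδeq, mul_smul] at hmem
    have hn : n = nv v := (T_zpow_smul_mem_strip_iff _ n).mp hmem
    refine ⟨v, ?_⟩
    rw [← hnvδ, hι, hn]
  rw [← hιinj.tsum_eq hsupp]
  refine tsum_congr fun v ↦ ?_
  have hmem : (ModularGroup.T ^ (nv v) • rowMatrix v.1 v.2.1 • w) ∈ {u : ℍ | 0 ≤ u.re ∧ u.re < 1} :=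
    (T_zpow_smul_mem_strip_iff _ (nv v)).mpr rfl
  simp only [hι, Subgroup.coe_mk, mul_smul]
  rw [Set.indicator_of_mem hmem, hT]

end Literature.NumberTheory.ModularForms.PoincareWeightTwo

end
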